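import Literature.Computability.AlgebraicComplexity.GlobalStageExponent
import Literature.Computability.AlgebraicComplexity.InterfaceEpsilonCells
import HarnessLib

/-!
# The data of one cell of an `ε`-interface tensor as the data of one region of Prop. 5.1
(Vassilevska Williams–Xu–Xu–Zhou 2024, proof of Thm. 5.3: "for each copy … we apply Prop. 5.1 where
the target complete split distributions are slightly different in each application") — proved

Topic `Literature/Computability/AlgebraicComplexity`.  The proof of Theorem 5.3 of Vassilevska
Williams–Xu–Xu–Zhou (SODA 2024, arXiv:2307.07970, p. 19) applies Prop. 5.1 once for every family
`{ξ_{W,i,j,k}}` of complete split distributions that are integral multiples of `1/(A_r α(i,j,k) n)` and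
within `ε` of the targets `{β_{W,i,j,k}}` — in the tree's language, once for every realised CELL of
the `ε`-interface tensor `𝒯_{τ₀, L(γ), ε}` (`InterfaceEpsilonCells.lean`: the cell of a non-zero entry
`(x, y, z)` is the exact interface tensor whose split distributions are the realised ones,
`cellTermList`).  This file supplies, for such a cell, the datum of one region of Prop. 5.1
(`GlobalStageData`, `GlobalStageStructure.lean`) and checks every hypothesis of the landed exact
one-region theorem `vxxz2024_prop51_region_logb` (`GlobalStageExponent.lean`):

* `typeAlpha`, `isAlphaConsistent_typeAlpha` — `α = Q/n` for a joint type `Q`; the triples of type `Q`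
  are `α`-consistent; `isLevelTriple_of_mem_jointTypeClass`;
* `cellGammaFun`, `tripleTermList_cellGammaFun` — the realised split distributions indexed by
  constituent triples; the parameter list of `𝒯*` built from them IS the cell parameter list;
* `cellData` and `cellData_wellFormed` — the datum (marginals and `α` of `Q`, realised `γ`'s,
  `𝒯α = jointTypeClass n Q`) is well formed: **Remark 5.2 holds automatically for realised
  distributions** (`cellGammaFun_revX/revY`: on a term `(i,0,k)` the `Y`-chunks have level `0`, so the
  realised `Z`-chunks are the reversed `X`-chunks, Claim 5.9), and symmetric (`cellData_symmetric`);
* `cellData_starTensor_eq` — the useful sub-tensor `𝒯*_{T₀}` of the datum is the cell's exact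
  interface tensor (Claim 5.11);
* `mem_typicalPairs_cell`, `mem_levelBlocksX_coarse_cell`, `coarseProfile`, `coarseProfile_eq_mul` —
  the realising `Z`-block `ẑ` is useful, hence typical and compatible′ (Def. 5.15), so `(K₀, ẑ)` is a
  typical pair and the class types `k_S` of `ẑ` are the integral data `|S| γ_S` of Claim 5.14;
* `crudeModulus`, `modulusBound_le_crudeModulus`, `thm53Err` — a cell-independent bound
  `M₀ ≤ (160cn + 2c + 11)(2c+1)^{3n}` making the lower-order term uniform (`O(√n)`);
* `vxxz2024_thm53_cell` — **Prop. 5.1 for the cell**: `(CW_q^{⊗c})^{⊗n} ≥ ⟨κ⟩ ⊗ 𝒯_cell` with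
  `log₂(κ+1) ≥ n · min{H(Q_X/n) − P, H(Q_Y/n) − P, H(θ_ẑ/n) − Λ_ẑ/n, H(Q/n)} − thm53Err`
  (`P` the penalty at the type, `θ_ẑ` the joint type of `(K₀, ẑ)`, `Λ_ẑ = ∑_S |S| H(k_S/|S|)`).

Everything is proved; the definitions are the data above; no named facts.  The comparison of the
cell exponent with the target exponent (continuity, `ShannonEntropyModulus.lean`) and the direct sum
over the cells (merge, `vxxz2024_thm53_merge`) are the remaining steps of Thm. 5.3.

## References

* V. Vassilevska Williams, Y. Xu, Z. Xu, R. Zhou, *New bounds for matrix multiplication: from alpha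
  to omega*, SODA 2024, arXiv:2307.07970 (held: `paper:arxiv-2307.07970`), Thm. 5.3 (proof),
  Prop. 5.1, Remark 5.2, Claim 5.11. [VassilevskaWilliamsXuXuZhou2024]
-/

noncomputable section

open scoped BigOperators
open Finset

namespace Literature.Computability.AlgebraicComplexity

open Literature.Barriers.MatrixMultiplication (bigCwTensor)

universe u

/-! ## The distribution `α` of a joint type -/

section TypeAlpha

variable {c n : ℕ}

/-- **`α = Q/n` read on `ℕ³`**: `α(i,j,k) = Q(i,j,k)/n` for indices `≤ 2c`, `0` elsewhere — the
distribution on constituent triples of which the triples of joint type `Q` are the `α`-consistent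
ones. [cite: VassilevskaWilliamsXuXuZhou2024, §5.2 ("block triples that are consistent with α")] -/
def typeAlpha (n : ℕ) (Q : Fin (2 * c + 1) × Fin (2 * c + 1) × Fin (2 * c + 1) → ℕ) : ℕ × ℕ × ℕ → ℝ :=
  fun ijk => if h : ijk.1 < 2 * c + 1 ∧ ijk.2.1 < 2 * c + 1 ∧ ijk.2.2 < 2 * c + 1 then
    ((Q (⟨ijk.1, h.1⟩, ⟨ijk.2.1, h.2.1⟩, ⟨ijk.2.2, h.2.2⟩) : ℕ) : ℝ) / n else 0

/-- On indices in range `typeAlpha` is `Q/n`. [folklore] -/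
theorem typeAlpha_apply_fin (Q : Fin (2 * c + 1) × Fin (2 * c + 1) × Fin (2 * c + 1) → ℕ)
    (i j k : Fin (2 * c + 1)) : typeAlpha n Q ((i : ℕ), (j : ℕ), (k : ℕ)) = (Q (i, j, k) : ℝ) / n := by
  unfold typeAlpha
  rw [dif_pos ⟨i.isLt, j.isLt, k.isLt⟩]

/-- The position class `S_{i,j,k}` of a triple of `Fin (2c+1)`-valued sequences, for indices in range,
is the set of positions where the label sequence takes the value `(i,j,k)`. [folklore] -/
theorem posClass_seqVal_eq (T : (Fin n → Fin (2 * c + 1)) × (Fin n → Fin (2 * c + 1)) × (Fin n → Fin (2 * c + 1)))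
    (i j k : Fin (2 * c + 1)) :
    posClass (seqVal T.1) (seqVal T.2.1) (seqVal T.2.2) i j k = univ.filter fun t => labelSeq T t = (i, j, k) := by
  ext t
  simp only [mem_posClass, mem_filter, mem_univ, true_and, seqVal, labelSeq, Prod.mk.injEq]
  rw [Fin.ext_iff, Fin.ext_iff, Fin.ext_iff]

/-- **Triples of joint type `Q` are `α`-consistent for `α = Q/n`.** [cite: VassilevskaWilliamsXuXuZhou2024, §5.2] -/
theorem isAlphaConsistent_typeAlpha {Q : Fin (2 * c + 1) × Fin (2 * c + 1) × Fin (2 * c + 1) → ℕ}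
    {T : (Fin n → Fin (2 * c + 1)) × (Fin n → Fin (2 * c + 1)) × (Fin n → Fin (2 * c + 1))}
    (hT : T ∈ jointTypeClass n Q) :
    IsAlphaConsistent (typeAlpha n Q) (seqVal T.1) (seqVal T.2.1) (seqVal T.2.2) := by
  have hQ : letterCount (labelSeq T) = Q := (mem_filter.1 hT).2
  intro i j k
  by_cases h : i < 2 * c + 1 ∧ j < 2 * c + 1 ∧ k < 2 * c + 1
  · have e := posClass_seqVal_eq T ⟨i, h.1⟩ ⟨j, h.2.1⟩ ⟨k, h.2.2⟩
    simp only at e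
    rw [e]
    unfold typeAlpha
    rw [dif_pos h, ← hQ, letterCount_apply]
    rcases Nat.eq_zero_or_pos n with hn | hn
    · subst hn
      simp
    · have : (n : ℝ) ≠ 0 := by exact_mod_cast hn.ne'
      rw [div_mul_cancel₀ _ this]
  · -- out of range: the class is empty and `α = 0`
    unfold typeAlpha
    rw [dif_neg h, zero_mul]
    have he : posClass (seqVal T.1) (seqVal T.2.1) (seqVal T.2.2) i j k = ∅ := by
      rw [Finset.eq_empty_iff_forall_notMem]
      intro t ht
      rw [mem_posClass] at ht
      obtain ⟨h1, h2, h3⟩ := ht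
      exact h ⟨h1 ▸ (T.1 t).isLt, h2 ▸ (T.2.1 t).isLt, h3 ▸ (T.2.2 t).isLt⟩
    rw [he, card_empty, Nat.cast_zero]

/-- A joint type realised by a level-`ℓ` block triple is supported on the level support. [cite: VassilevskaWilliamsXuXuZhou2024, §5.2] -/
theorem type_eq_zero_of_not_mem_levelSupport {Q : Fin (2 * c + 1) × Fin (2 * c + 1) × Fin (2 * c + 1) → ℕ}
    {T : (Fin n → Fin (2 * c + 1)) × (Fin n → Fin (2 * c + 1)) × (Fin n → Fin (2 * c + 1))}
    (hT : T ∈ jointTypeClass n Q) (hlev : IsLevelTriple c (seqVal T.1) (seqVal T.2.1) (seqVal T.2.2)) :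
    ∀ s, s ∉ levelSupport (2 * c) → Q s = 0 := by
  have hQ : letterCount (labelSeq T) = Q := (mem_filter.1 hT).2
  intro s hs
  rw [← hQ, letterCount_apply, card_eq_zero, filter_eq_empty_iff]
  intro t _ hts
  apply hs
  rw [mem_levelSupport, ← hts]
  exact hlev t

/-- Conversely a triple of a joint type supported on the level support is a level-`ℓ` block triple. [cite: VassilevskaWilliamsXuXuZhou2024, §5.2] -/
theorem isLevelTriple_of_mem_jointTypeClass {Q : Fin (2 * c + 1) × Fin (2 * c + 1) × Fin (2 * c + 1) → ℕ}
    (hQs : ∀ s, s ∉ levelSupport (2 * c) → Q s = 0)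
    {T : (Fin n → Fin (2 * c + 1)) × (Fin n → Fin (2 * c + 1)) × (Fin n → Fin (2 * c + 1))}
    (hT : T ∈ jointTypeClass n Q) : IsLevelTriple c (seqVal T.1) (seqVal T.2.1) (seqVal T.2.2) := by
  have hsub := jointTypeClass_subset_typedSupport (levelSupport (2 * c)) Q hQs hT
  exact fun t => levelSum_of_mem_typedSupport hsub t

end TypeAlpha

/-! ## The split distributions of a cell as functions on `ℕ³` -/

section CellGamma

variable {c n : ℕ}

/-- **The split distributions of a cell, indexed by constituent triples**: `(i,j,k) ↦ a_t / n_t` for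
the term `t` of `(i,j,k)`, `0` off the constituent triples. [cite: VassilevskaWilliamsXuXuZhou2024, Thm. 5.3 (proof: the ξ_{W,i,j,k})] -/
def cellGammaFun (τ : Fin n → Fin (constituentTriples c).card)
    (a : Fin (constituentTriples c).card → (Fin c → Fin 3) → Fin (n + 1)) : ℕ × ℕ × ℕ → (Fin c → Fin 3) → ℝ :=
  fun ijk => if h : ijk ∈ constituentTriples c then cellGamma τ a ((constituentTriples c).equivFin ⟨ijk, h⟩) else 0

/-- On a constituent triple, `cellGammaFun` is the cell distribution of its term. [folklore] -/
theorem cellGammaFun_of_mem (τ : Fin n → Fin (constituentTriples c).card)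
    (a : Fin (constituentTriples c).card → (Fin c → Fin 3) → Fin (n + 1)) {ijk : ℕ × ℕ × ℕ} (h : ijk ∈ constituentTriples c) :
    cellGammaFun τ a ijk = cellGamma τ a ((constituentTriples c).equivFin ⟨ijk, h⟩) := by
  unfold cellGammaFun; rw [dif_pos h]

/-- Off the constituent triples, `cellGammaFun = 0`. [folklore] -/
theorem cellGammaFun_of_not_mem (τ : Fin n → Fin (constituentTriples c).card)
    (a : Fin (constituentTriples c).card → (Fin c → Fin 3) → Fin (n + 1)) {ijk : ℕ × ℕ × ℕ} (h : ijk ∉ constituentTriples c) :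
    cellGammaFun τ a ijk = 0 := by
  unfold cellGammaFun; rw [dif_neg h]

/-- At the triple of a term index. [folklore] -/
theorem cellGammaFun_symm_apply (τ : Fin n → Fin (constituentTriples c).card)
    (a : Fin (constituentTriples c).card → (Fin c → Fin 3) → Fin (n + 1)) (s : Fin (constituentTriples c).card) :
    cellGammaFun τ a ((constituentTriples c).equivFin.symm s).1 = cellGamma τ a s := by
  rw [cellGammaFun_of_mem τ a ((constituentTriples c).equivFin.symm s).2]
  simp

/-- **The parameter list of `𝒯*` with the cell distributions is the cell parameter list** of the
`ε`-interface tensor `𝒯_{τ₀, L(γ), ε}` (`L(γ) = tripleTermList c γ_X γ_Y γ_Z`). [cite: VassilevskaWilliamsXuXuZhou2024, Thm. 5.3 (proof, eq. (param-list-2))] -/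
theorem tripleTermList_cellGammaFun (τ : Fin n → Fin (constituentTriples c).card)
    (γX γY γZ : ℕ × ℕ × ℕ → (Fin c → Fin 3) → ℝ)
    (abc : (Fin (constituentTriples c).card → (Fin c → Fin 3) → Fin (n + 1)) ×
      (Fin (constituentTriples c).card → (Fin c → Fin 3) → Fin (n + 1)) ×
      (Fin (constituentTriples c).card → (Fin c → Fin 3) → Fin (n + 1))) :
    tripleTermList c (cellGammaFun τ abc.1) (cellGammaFun τ abc.2.1) (cellGammaFun τ abc.2.2) =
      cellTermList τ (tripleTermList c γX γY γZ) abc := by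
  funext s
  simp only [tripleTermList, cellTermList, cellGammaFun_symm_apply]

end CellGamma

/-! ## Level conditions of the blocks of `𝒯_{τ₀, L(γ), ε}` -/

section Levels

variable {c n : ℕ}

/-- The level-1 `X`-blocks of `𝒯_{τ₀,L(γ),ε}` (any `ε`) lie in the level-`ℓ` block `X_I`. [cite: VassilevskaWilliamsXuXuZhou2024, Def. 4.1] -/
theorem chunkLevels_eq_of_mem_levelBlocksX_triple {I J K : Fin n → ℕ} (h : IsLevelTriple c I J K)
    {γX γY γZ : ℕ × ℕ × ℕ → (Fin c → Fin 3) → ℝ} {ε : ℝ} {Ih : Fin n → Fin c → Fin 3}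
    (hI : Ih ∈ levelBlocksX (tripleTermMap h) (tripleTermList c γX γY γZ) ε) : chunkLevels Ih = I := by
  funext u
  have := (mem_admissibleSeqs.1 hI).1 u
  simpa [tripleTermList, tripleTermMap] using this

/-- The level-1 `Y`-blocks of `𝒯_{τ₀,L(γ),ε}` lie in `Y_J`. [cite: VassilevskaWilliamsXuXuZhou2024, Def. 4.1] -/
theorem chunkLevels_eq_of_mem_levelBlocksY_triple {I J K : Fin n → ℕ} (h : IsLevelTriple c I J K)
    {γX γY γZ : ℕ × ℕ × ℕ → (Fin c → Fin 3) → ℝ} {ε : ℝ} {Jh : Fin n → Fin c → Fin 3}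
    (hJ : Jh ∈ levelBlocksY (tripleTermMap h) (tripleTermList c γX γY γZ) ε) : chunkLevels Jh = J := by
  funext u
  have := (mem_admissibleSeqs.1 hJ).1 u
  simpa [tripleTermList, tripleTermMap] using this

/-- The level-1 `Z`-blocks of `𝒯_{τ₀,L(γ),ε}` lie in `Z_K`. [cite: VassilevskaWilliamsXuXuZhou2024, Def. 4.1] -/
theorem chunkLevels_eq_of_mem_levelBlocksZ_triple {I J K : Fin n → ℕ} (h : IsLevelTriple c I J K)
    {γX γY γZ : ℕ × ℕ × ℕ → (Fin c → Fin 3) → ℝ} {ε : ℝ} {Kh : Fin n → Fin c → Fin 3}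
    (hK : Kh ∈ levelBlocksZ (tripleTermMap h) (tripleTermList c γX γY γZ) ε) : chunkLevels Kh = K := by
  funext u
  have := (mem_admissibleSeqs.1 hK).1 u
  simpa [tripleTermList, tripleTermMap] using this

/-- The fibre of the term map over the term of `(i,j,k)` is `S_{i,j,k}`. [cite: VassilevskaWilliamsXuXuZhou2024, §5.3 and §5.5] -/
theorem termFibre_tripleTermMap_equivFin {I J K : Fin n → ℕ} (h : IsLevelTriple c I J K) {ijk : ℕ × ℕ × ℕ}
    (hm : ijk ∈ constituentTriples c) :
    termFibre (tripleTermMap h) ((constituentTriples c).equivFin ⟨ijk, hm⟩) = posClass I J K ijk.1 ijk.2.1 ijk.2.2 := by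
  dsimp only [termFibre]
  rw [filter_tripleTermMap_eq h]
  simp

/-- A non-zero entry of an interface tensor is a supported entry of the power. [cite: VassilevskaWilliamsXuXuZhou2024, Def. 4.1] -/
theorem kroneckerPow_ne_zero_of_interfaceTensor_ne_zero (K : Type u) [CommSemiring K] (q : ℕ) {s : ℕ}
    {τ : Fin n → Fin s} {L : Fin s → InterfaceTerm c} {ε : ℝ} {x y z : Fin n → Fin c → Fin (q + 2)}
    (h : interfaceTensor K q τ L ε x y z ≠ 0) : kroneckerPow (kroneckerPow (bigCwTensor K q) c) n x y z ≠ 0 := by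
  intro h0
  apply h
  rw [interfaceTensor, partSubtensor_apply]
  split_ifs
  · exact h0
  · rfl

end Levels

/-! ## The data of a cell -/

section CellData

variable {c n : ℕ}

/-- **The data of one region of Prop. 5.1 for a cell of `𝒯_{τ₀, L(γ), ε}`**: marginal types and
`α = Q/n` of the joint type `Q`, the REALISED split distributions of the cell, `𝒯α` = all triples of
joint type `Q`, and (irrelevant here) `B = ∅`. [cite: VassilevskaWilliamsXuXuZhou2024, Thm. 5.3 (proof: "we apply Prop. 5.1 where the target complete split distributions are slightly different in each application")] -/
def cellData (Q : Fin (2 * c + 1) × Fin (2 * c + 1) × Fin (2 * c + 1) → ℕ)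
    (τ : Fin n → Fin (constituentTriples c).card)
    (abc : (Fin (constituentTriples c).card → (Fin c → Fin 3) → Fin (n + 1)) ×
      (Fin (constituentTriples c).card → (Fin c → Fin 3) → Fin (n + 1)) ×
      (Fin (constituentTriples c).card → (Fin c → Fin 3) → Fin (n + 1))) : GlobalStageData c n 0 where
  μX := fun i => ∑ j, ∑ l, Q (i, j, l)
  μY := fun j => ∑ i, ∑ l, Q (i, j, l)
  μZ := fun l => ∑ i, ∑ j, Q (i, j, l)
  α := typeAlpha n Q
  γX := cellGammaFun τ abc.1
  γY := cellGammaFun τ abc.2.1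
  γZ := cellGammaFun τ abc.2.2
  𝒯α := jointTypeClass n Q
  B := ∅

variable (Q : Fin (2 * c + 1) × Fin (2 * c + 1) × Fin (2 * c + 1) → ℕ) (τ : Fin n → Fin (constituentTriples c).card)
  (abc : (Fin (constituentTriples c).card → (Fin c → Fin 3) → Fin (n + 1)) ×
    (Fin (constituentTriples c).card → (Fin c → Fin 3) → Fin (n + 1)) ×
    (Fin (constituentTriples c).card → (Fin c → Fin 3) → Fin (n + 1)))

/-- Field of the cell data. [folklore] -/
@[simp] theorem cellData_μX : (cellData Q τ abc).μX = fun i => ∑ j, ∑ l, Q (i, j, l) := rfl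
/-- Field of the cell data. [folklore] -/
@[simp] theorem cellData_μY : (cellData Q τ abc).μY = fun j => ∑ i, ∑ l, Q (i, j, l) := rfl
/-- Field of the cell data. [folklore] -/
@[simp] theorem cellData_μZ : (cellData Q τ abc).μZ = fun l => ∑ i, ∑ j, Q (i, j, l) := rfl
/-- Field of the cell data. [folklore] -/
@[simp] theorem cellData_α : (cellData Q τ abc).α = typeAlpha n Q := rfl
/-- Field of the cell data. [folklore] -/
@[simp] theorem cellData_γX : (cellData Q τ abc).γX = cellGammaFun τ abc.1 := rfl
/-- Field of the cell data. [folklore] -/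
@[simp] theorem cellData_γY : (cellData Q τ abc).γY = cellGammaFun τ abc.2.1 := rfl
/-- Field of the cell data. [folklore] -/
@[simp] theorem cellData_γZ : (cellData Q τ abc).γZ = cellGammaFun τ abc.2.2 := rfl
/-- Field of the cell data. [folklore] -/
@[simp] theorem cellData_𝒯α : (cellData Q τ abc).𝒯α = jointTypeClass n Q := rfl

/-- The cell data is symmetric (`𝒯α` is a full joint type class). [cite: VassilevskaWilliamsXuXuZhou2024, Def. 5.13 ("By symmetry")] -/
theorem cellData_symmetric : (cellData Q τ abc).Symmetric :=
  GlobalStageData.symmetric_of_eq_jointTypeClass rfl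

variable {Q}

/-- `𝒯α ⊆ 𝒯` for the cell data, when `Q` is supported on the level support. [cite: VassilevskaWilliamsXuXuZhou2024, §5.2] -/
theorem cellData_subset (hQs : ∀ s, s ∉ levelSupport (2 * c) → Q s = 0) :
    (cellData Q τ abc).𝒯α ⊆ (cellData Q τ abc).tripleSet :=
  jointTypeClass_subset_typedSupport (levelSupport (2 * c)) Q hQs

/-- **The useful sub-tensor of the cell data over `T₀` is the exact interface tensor of the cell**
(Claim 5.11 for the cell distributions). [cite: VassilevskaWilliamsXuXuZhou2024, Claim 5.11 and Thm. 5.3 (proof)] -/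
theorem cellData_starTensor_eq (R : Type u) [CommSemiring R] (q : ℕ)
    {T₀ : (Fin n → Fin (2 * c + 1)) × (Fin n → Fin (2 * c + 1)) × (Fin n → Fin (2 * c + 1))}
    (hlev : IsLevelTriple c (seqVal T₀.1) (seqVal T₀.2.1) (seqVal T₀.2.2))
    (γX γY γZ : ℕ × ℕ × ℕ → (Fin c → Fin 3) → ℝ)
    (abc' : (Fin (constituentTriples c).card → (Fin c → Fin 3) → Fin (n + 1)) ×
      (Fin (constituentTriples c).card → (Fin c → Fin 3) → Fin (n + 1)) ×
      (Fin (constituentTriples c).card → (Fin c → Fin 3) → Fin (n + 1))) :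
    (cellData Q (tripleTermMap hlev) abc').starTensor R q T₀ =
      interfaceTensor R q (tripleTermMap hlev) (cellTermList (tripleTermMap hlev) (tripleTermList c γX γY γZ) abc') 0 := by
  rw [GlobalStageData.starTensor, usefulSubtensor_eq_interfaceTensor R q hlev]
  simp only [cellData_γX, cellData_γY, cellData_γZ]
  rw [tripleTermList_cellGammaFun]

end CellData

/-! ## A realised cell: Remark 5.2, usefulness and typicality of the realising `Z`-block -/

section Realised

variable (K : Type u) [CommSemiring K] (q : ℕ) {c n : ℕ}
variable {Q : Fin (2 * c + 1) × Fin (2 * c + 1) × Fin (2 * c + 1) → ℕ}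
variable {T₀ : (Fin n → Fin (2 * c + 1)) × (Fin n → Fin (2 * c + 1)) × (Fin n → Fin (2 * c + 1))}
variable {γX γY γZ : ℕ × ℕ × ℕ → (Fin c → Fin 3) → ℝ} {ε : ℝ} {x y z : Fin n → Fin c → Fin (q + 2)}

/-- **Remark 5.2 holds for the realised split distributions of a cell, `X`-form**:
`ξ_{Z,i,0,k}(L) = ξ_{X,i,0,k}(2⃗ − L)` — on the chunks of the term `(i,0,k)` the `Y`-block has level
`0`, so the `Z`-chunks are the reversed `X`-chunks (Claim 5.9). [cite: VassilevskaWilliamsXuXuZhou2024, Remark 5.2 and Claim 5.9] -/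
theorem cellGammaFun_revX (hlev : IsLevelTriple c (seqVal T₀.1) (seqVal T₀.2.1) (seqVal T₀.2.2))
    (hxyz : interfaceTensor K q (tripleTermMap hlev) (tripleTermList c γX γY γZ) ε x y z ≠ 0) (i k : ℕ) (σ : Fin c → Fin 3) :
    cellGammaFun (tripleTermMap hlev) (profileOf q (tripleTermMap hlev) z) (i, 0, k) σ =
      cellGammaFun (tripleTermMap hlev) (profileOf q (tripleTermMap hlev) x) (i, 0, k) (fun p => (σ p).rev) := by
  by_cases hm : ((i, 0, k) : ℕ × ℕ × ℕ) ∈ constituentTriples c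
  · rw [cellGammaFun_of_mem _ _ hm, cellGammaFun_of_mem _ _ hm]
    set s := (constituentTriples c).equivFin ⟨(i, 0, k), hm⟩ with hs
    have hfib : termFibre (tripleTermMap hlev) s = posClass (seqVal T₀.1) (seqVal T₀.2.1) (seqVal T₀.2.2) i 0 k :=
      termFibre_tripleTermMap_equivFin hlev hm
    have hpow := kroneckerPow_ne_zero_of_interfaceTensor_ne_zero K q hxyz
    have hy : chunkLevels (levelSeq y) = seqVal T₀.2.1 :=
      chunkLevels_eq_of_mem_levelBlocksY_triple hlev (interfaceTensor_ne_zero K q hxyz).2.1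
    change completeSplitOn (levelSeq z) (termFibre (tripleTermMap hlev) s) σ =
      completeSplitOn (levelSeq x) (termFibre (tripleTermMap hlev) s) (fun p => (σ p).rev)
    rw [hfib]
    refine completeSplitOn_rev_on (fun t ht => levelSeq_eq_rev_of_chunkLevels_eq_zero K q hpow ?_) σ
    rw [hy]
    exact (mem_posClass.1 ht).2.1
  · rw [cellGammaFun_of_not_mem _ _ hm, cellGammaFun_of_not_mem _ _ hm]; rfl

/-- **Remark 5.2, `Y`-form**: `ξ_{Z,0,j,k}(L) = ξ_{Y,0,j,k}(2⃗ − L)`. [cite: VassilevskaWilliamsXuXuZhou2024, Remark 5.2 and Claim 5.9] -/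
theorem cellGammaFun_revY (hlev : IsLevelTriple c (seqVal T₀.1) (seqVal T₀.2.1) (seqVal T₀.2.2))
    (hxyz : interfaceTensor K q (tripleTermMap hlev) (tripleTermList c γX γY γZ) ε x y z ≠ 0) (j k : ℕ) (σ : Fin c → Fin 3) :
    cellGammaFun (tripleTermMap hlev) (profileOf q (tripleTermMap hlev) z) (0, j, k) σ =
      cellGammaFun (tripleTermMap hlev) (profileOf q (tripleTermMap hlev) y) (0, j, k) (fun p => (σ p).rev) := by
  by_cases hm : ((0, j, k) : ℕ × ℕ × ℕ) ∈ constituentTriples c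
  · rw [cellGammaFun_of_mem _ _ hm, cellGammaFun_of_mem _ _ hm]
    set s := (constituentTriples c).equivFin ⟨(0, j, k), hm⟩ with hs
    have hfib : termFibre (tripleTermMap hlev) s = posClass (seqVal T₀.1) (seqVal T₀.2.1) (seqVal T₀.2.2) 0 j k :=
      termFibre_tripleTermMap_equivFin hlev hm
    have hpow := kroneckerPow_ne_zero_of_interfaceTensor_ne_zero K q hxyz
    have hx : chunkLevels (levelSeq x) = seqVal T₀.1 :=
      chunkLevels_eq_of_mem_levelBlocksX_triple hlev (interfaceTensor_ne_zero K q hxyz).1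
    change completeSplitOn (levelSeq z) (termFibre (tripleTermMap hlev) s) σ =
      completeSplitOn (levelSeq y) (termFibre (tripleTermMap hlev) s) (fun p => (σ p).rev)
    rw [hfib]
    refine completeSplitOn_rev_on (fun t ht => levelSeq_eq_rev_of_chunkLevels_eq_zero' K q hpow ?_) σ
    rw [hx]
    exact (mem_posClass.1 ht).1
  · rw [cellGammaFun_of_not_mem _ _ hm, cellGammaFun_of_not_mem _ _ hm]; rfl

/-- **The cell data of a realised cell is well formed.** [cite: VassilevskaWilliamsXuXuZhou2024, Prop. 5.1 and Remark 5.2] -/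
theorem cellData_wellFormed (hQs : ∀ s, s ∉ levelSupport (2 * c) → Q s = 0) (hT₀ : T₀ ∈ jointTypeClass n Q)
    (hxyz : interfaceTensor K q (tripleTermMap (isLevelTriple_of_mem_jointTypeClass hQs hT₀)) (tripleTermList c γX γY γZ) ε x y z ≠ 0) :
    (cellData Q (tripleTermMap (isLevelTriple_of_mem_jointTypeClass hQs hT₀))
      (profileOf q (tripleTermMap (isLevelTriple_of_mem_jointTypeClass hQs hT₀)) x,
        profileOf q (tripleTermMap (isLevelTriple_of_mem_jointTypeClass hQs hT₀)) y,
        profileOf q (tripleTermMap (isLevelTriple_of_mem_jointTypeClass hQs hT₀)) z)).WellFormed where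
  subset := cellData_subset _ _ hQs
  alphaConsistent := fun _ hT => isAlphaConsistent_typeAlpha hT
  revX := fun i k σ => cellGammaFun_revX K q _ hxyz i k σ
  revY := fun j k σ => cellGammaFun_revY K q _ hxyz j k σ

/-- **The realising `Z`-block is useful for `T₀` w.r.t. the cell distributions** (its split
distribution on every class IS the cell distribution). [cite: VassilevskaWilliamsXuXuZhou2024, Def. 5.10 and Thm. 5.3 (proof)] -/
theorem isUsefulFor_cell (hlev : IsLevelTriple c (seqVal T₀.1) (seqVal T₀.2.1) (seqVal T₀.2.2))
    (hz : levelSeq z ∈ levelBlocksZ (tripleTermMap hlev) (tripleTermList c γX γY γZ) ε)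
    (a b : Fin (constituentTriples c).card → (Fin c → Fin 3) → Fin (n + 1)) :
    chunkLevels (levelSeq z) = seqVal T₀.2.2 ∧
      IsUsefulFor (cellGammaFun (tripleTermMap hlev) (profileOf q (tripleTermMap hlev) z))
        (seqVal T₀.1) (seqVal T₀.2.1) (seqVal T₀.2.2) (levelSeq z) := by
  have hmem : levelSeq z ∈ levelBlocksZ (tripleTermMap hlev)
      (cellTermList (tripleTermMap hlev) (tripleTermList c γX γY γZ) (a, b, profileOf q (tripleTermMap hlev) z)) 0 :=
    (mem_admissibleSeqs_cell_iff hz (levelSeq z)).2 rfl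
  rw [← tripleTermList_cellGammaFun, mem_levelBlocksZ_triple_iff hlev] at hmem
  exact hmem

/-- **The pair `(Z_{K₀}, realising Z-block)` is a typical pair of the cell data** (useful ⇒ typical,
Claim 5.11). [cite: VassilevskaWilliamsXuXuZhou2024, Def. 5.12 and Claim 5.11 (proof)] -/
theorem mem_typicalPairs_cell (hQs : ∀ s, s ∉ levelSupport (2 * c) → Q s = 0) (hT₀ : T₀ ∈ jointTypeClass n Q)
    (hz : levelSeq z ∈ levelBlocksZ (tripleTermMap (isLevelTriple_of_mem_jointTypeClass hQs hT₀)) (tripleTermList c γX γY γZ) ε)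
    (a b : Fin (constituentTriples c).card → (Fin c → Fin 3) → Fin (n + 1)) :
    (T₀.2.2, levelSeq z) ∈ (cellData Q (tripleTermMap (isLevelTriple_of_mem_jointTypeClass hQs hT₀))
      (a, b, profileOf q (tripleTermMap (isLevelTriple_of_mem_jointTypeClass hQs hT₀)) z)).typicalPairs := by
  classical
  have hlev := isLevelTriple_of_mem_jointTypeClass hQs hT₀
  obtain ⟨hlz, hu⟩ := isUsefulFor_cell q hlev hz a b
  unfold GlobalStageData.typicalPairs
  refine mem_filter.2 ⟨mem_univ _, ?_, ?_, ?_⟩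
  · have hsub := jointTypeClass_subset_typedSupport (levelSupport (2 * c)) Q hQs hT₀
    exact (mem_typedSupport.1 hsub).2.2.1
  · exact chunkLevels_eq_iff.1 hlz
  · exact hu.isTypical hlev (isAlphaConsistent_typeAlpha hT₀)

end Realised

/-! ## The class types `k_S` of the realising `Z`-block (the integral data of Claim 5.14) -/

section CoarseProfile

variable {c n : ℕ}

/-- **The class types of a level-1 `Z`-sequence**: for each coarse class `S` (Def. 5.15) and chunk
shape `σ`, the number of chunks of `S` of shape `σ` (so `k_S/|S| = split(K̂, S)`).
[cite: VassilevskaWilliamsXuXuZhou2024, Def. 5.15 and Claim 5.14 (proof)] -/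
def coarseProfile {I J K : Fin n → ℕ} (h : IsLevelTriple c I J K) (Kh : Fin n → Fin c → Fin 3) :
    Fin (coarseClasses c).card → (Fin c → Fin 3) → ℕ :=
  fun s σ => ((termFibre (coarseTermMap h) s).filter fun u => Kh u = σ).card

/-- `∑_σ k_S(σ) = |S|`. [folklore] -/
theorem sum_coarseProfile {I J K : Fin n → ℕ} (h : IsLevelTriple c I J K) (Kh : Fin n → Fin c → Fin 3)
    (s : Fin (coarseClasses c).card) : ∑ σ, coarseProfile h Kh s σ = (termFibre (coarseTermMap h) s).card := by
  unfold coarseProfile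
  exact (card_eq_sum_card_fiberwise (f := Kh) (s := termFibre (coarseTermMap h) s) (t := univ)
    fun _ _ => mem_univ _).symm

/-- For a sequence admissible for the coarse datum, `k_S` is supported on shapes of the class level. [cite: VassilevskaWilliamsXuXuZhou2024, Def. 5.15] -/
theorem patternLevel_of_coarseProfile_ne_zero {α : ℕ × ℕ × ℕ → ℝ} {γZ : ℕ × ℕ × ℕ → (Fin c → Fin 3) → ℝ}
    {I J K : Fin n → ℕ} (h : IsLevelTriple c I J K) {Kh : Fin n → Fin c → Fin 3}
    (hK : Kh ∈ levelBlocksX (coarseTermMap h) (coarseTermList c α γZ) 0) {s : Fin (coarseClasses c).card}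
    {σ : Fin c → Fin 3} (hne : coarseProfile h Kh s σ ≠ 0) : patternLevel σ = (coarseTermList c α γZ s).i := by
  unfold coarseProfile at hne
  obtain ⟨u, hu⟩ := card_pos.1 (Nat.pos_of_ne_zero hne)
  rw [mem_filter] at hu
  obtain ⟨hu1, hu2⟩ := hu
  have hus : coarseTermMap h u = s := by simpa [termFibre] using hu1
  have hlevel := (mem_admissibleSeqs.1 hK).1 u
  rw [← hu2, hlevel, hus]

/-- For a sequence admissible for the coarse datum, **`k_S = |S| · γ_S`** (the integrality used in
Claim 5.14's count `C = ∏_S binom(|S|; k_S)`). [cite: VassilevskaWilliamsXuXuZhou2024, Claim 5.14 (proof)] -/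
theorem coarseProfile_eq_mul {α : ℕ × ℕ × ℕ → ℝ} {γZ : ℕ × ℕ × ℕ → (Fin c → Fin 3) → ℝ}
    {I J K : Fin n → ℕ} (h : IsLevelTriple c I J K) {Kh : Fin n → Fin c → Fin 3}
    (hK : Kh ∈ levelBlocksX (coarseTermMap h) (coarseTermList c α γZ) 0) (s : Fin (coarseClasses c).card)
    (σ : Fin c → Fin 3) :
    (coarseProfile h Kh s σ : ℝ) = (termFibre (coarseTermMap h) s).card * (coarseTermList c α γZ s).γX σ := by
  have hmul : (coarseProfile h Kh s σ : ℝ) = completeSplitOn Kh (termFibre (coarseTermMap h) s) σ *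
      (termFibre (coarseTermMap h) s).card := (completeSplitOn_mul_card Kh _ σ).symm
  rcases (termFibre (coarseTermMap h) s).eq_empty_or_nonempty with h0 | hne
  · rw [hmul, h0, card_empty, Nat.cast_zero, mul_zero, zero_mul]
  · have hcons := (mem_admissibleSeqs.1 hK).2 s hne
    rw [splitConsistentOn_zero_iff] at hcons
    have hσ : completeSplitOn Kh (termFibre (coarseTermMap h) s) σ = (coarseTermList c α γZ s).γX σ := by
      have := congrFun hcons σ; simpa using this
    rw [hmul, hσ, mul_comm]

end CoarseProfile

/-! ## A uniform bound on the modulus `M₀` -/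

section Crude

variable {c n M : ℕ}

/-- **A crude bound for `M₀`**: `(160 c n + 2c + 11) · (2c+1)^{3n}` (all counts are at most the number
`(2c+1)^{3n}` of triples of sequences). [cite: VassilevskaWilliamsXuXuZhou2024, §5.6 (M₀)] -/
def crudeModulus (c n : ℕ) : ℕ := (160 * (c * n) + 2 * c + 11) * (2 * c + 1) ^ (3 * n)

/-- The number of triples of level-`ℓ` index sequences. [folklore] -/
theorem card_tripleSeqs (c n : ℕ) :
    Fintype.card ((Fin n → Fin (2 * c + 1)) × (Fin n → Fin (2 * c + 1)) × (Fin n → Fin (2 * c + 1))) =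
      (2 * c + 1) ^ (3 * n) := by
  simp only [Fintype.card_prod, Fintype.card_fun, Fintype.card_fin]
  ring

/-- **`M₀ ≤ crudeModulus`** for every datum and every pair. [cite: VassilevskaWilliamsXuXuZhou2024, §5.6 (M₀)] -/
theorem GlobalStageData.modulusBound_le_crudeModulus (D : GlobalStageData c n M)
    (p₀ : (Fin n → Fin (2 * c + 1)) × (Fin n → Fin c → Fin 3)) : D.modulusBound p₀ ≤ crudeModulus c n := by
  classical
  set F := (2 * c + 1) ^ (3 * n) with hF
  have hT : D.tripleSet.card ≤ F := by rw [hF, ← card_tripleSeqs c n]; exact card_le_univ _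
  have hV : (D.compatTriples p₀.1 p₀.2).card ≤ F := by rw [hF, ← card_tripleSeqs c n]; exact card_le_univ _
  have hF1 : 1 ≤ F := Nat.one_le_pow _ _ (by omega)
  have hXdiv : 8 * D.tripleSet.card / (typeClass n D.μX).card + 1 ≤ 8 * F + 1 :=
    Nat.add_le_add_right ((Nat.div_le_self _ _).trans (Nat.mul_le_mul_left 8 hT)) 1
  have hYdiv : 8 * D.tripleSet.card / (typeClass n D.μY).card + 1 ≤ 8 * F + 1 :=
    Nat.add_le_add_right ((Nat.div_le_self _ _).trans (Nat.mul_le_mul_left 8 hT)) 1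
  have h8 : 8 * F + 1 ≤ crudeModulus c n := by
    unfold crudeModulus; rw [← hF]
    calc 8 * F + 1 ≤ 8 * F + 3 * F := by omega
      _ = 11 * F := by ring
      _ ≤ (160 * (c * n) + 2 * c + 11) * F := Nat.mul_le_mul_right _ (by omega)
  have h160 : 160 * (c * n) * (D.compatTriples p₀.1 p₀.2).card ≤ crudeModulus c n := by
    unfold crudeModulus; rw [← hF]
    calc 160 * (c * n) * (D.compatTriples p₀.1 p₀.2).card ≤ 160 * (c * n) * F := Nat.mul_le_mul_left _ hV
      _ ≤ (160 * (c * n) + 2 * c + 11) * F := Nat.mul_le_mul_right _ (by omega)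
  have h2c : 2 * c + 2 ≤ crudeModulus c n := by
    unfold crudeModulus; rw [← hF]
    calc 2 * c + 2 = (2 * c + 2) * 1 := (mul_one _).symm
      _ ≤ (2 * c + 2) * F := Nat.mul_le_mul_left _ hF1
      _ ≤ (160 * (c * n) + 2 * c + 11) * F := Nat.mul_le_mul_right _ (by omega)
  unfold GlobalStageData.modulusBound
  exact max_le (max_le (hXdiv.trans h8) (hYdiv.trans h8)) (max_le h160 h2c)

/-- The square-root term of the error is monotone in the modulus bound. [folklore] -/
theorem sqrt_log_modulusBound_le (D : GlobalStageData c n M) (p₀ : (Fin n → Fin (2 * c + 1)) × (Fin n → Fin c → Fin 3)) :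
    4 * Real.sqrt (Real.log (2 * D.modulusBound p₀)) / Real.log 2 ≤
      4 * Real.sqrt (Real.log (2 * crudeModulus c n)) / Real.log 2 := by
  have hpos : 0 < D.modulusBound p₀ := by
    have : 2 * c + 2 ≤ D.modulusBound p₀ := le_max_of_le_right (le_max_right _ _)
    omega
  have hle : (D.modulusBound p₀ : ℝ) ≤ crudeModulus c n := by exact_mod_cast D.modulusBound_le_crudeModulus p₀
  have h0 : (0 : ℝ) < 2 * D.modulusBound p₀ := by positivity
  refine div_le_div_of_nonneg_right ?_ (Real.log_nonneg one_le_two)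
  refine mul_le_mul_of_nonneg_left (Real.sqrt_le_sqrt (Real.log_le_log h0 (by linarith))) (by norm_num)

/-- **The lower-order term of Thm. 5.3 (one region) at fixed `n`**:
`(2|S₃| + 2c+1 + |A_pair|) log₂(n+1) + log₂(160cn) + log₂(2c+2) + log₂ r₀ + 4√(log 2M̄)/log 2 + 7` with
`r₀ = 8^{3⌊log_{2N}3^N⌋+3}` and `M̄ = crudeModulus` — an explicit `O(√n)`. [cite: VassilevskaWilliamsXuXuZhou2024, Thm. 5.3 ("− o(n)")] -/
def thm53Err (c n : ℕ) : ℝ :=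
  (2 * Fintype.card (Fin (2 * c + 1) × Fin (2 * c + 1) × Fin (2 * c + 1)) + (2 * c + 1) +
        Fintype.card (Fin (2 * c + 1) × (Fin c → Fin 3))) * Real.logb 2 ((n : ℝ) + 1) +
      Real.logb 2 (160 * (c * n)) + Real.logb 2 (2 * c + 2) +
      Real.logb 2 ((8 ^ (3 * Nat.log (2 * (c * n)) (3 ^ (c * n)) + 3) : ℕ) : ℝ) +
    4 * Real.sqrt (Real.log (2 * crudeModulus c n)) / Real.log 2 + 7

end Crude

/-! ## Prop. 5.1 applied to a realised cell -/

section Cell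

variable (K : Type u) [CommSemiring K] (q : ℕ) {c n : ℕ}
variable {Q : Fin (2 * c + 1) × Fin (2 * c + 1) × Fin (2 * c + 1) → ℕ}
variable {T₀ : (Fin n → Fin (2 * c + 1)) × (Fin n → Fin (2 * c + 1)) × (Fin n → Fin (2 * c + 1))}
variable {γX γY γZ : ℕ × ℕ × ℕ → (Fin c → Fin 3) → ℝ} {ε : ℝ} {x y z : Fin n → Fin c → Fin (q + 2)}

/-- The realising `Z`-block is admissible for the coarse datum of the cell (useful ⇒ compatible ⇒
compatible′, Claim 5.11 / Def. 5.15). [cite: VassilevskaWilliamsXuXuZhou2024, Def. 5.15 and Claim 5.11 (proof)] -/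
theorem mem_levelBlocksX_coarse_cell (hQs : ∀ s, s ∉ levelSupport (2 * c) → Q s = 0) (hT₀ : T₀ ∈ jointTypeClass n Q)
    (hz : levelSeq z ∈ levelBlocksZ (tripleTermMap (isLevelTriple_of_mem_jointTypeClass hQs hT₀)) (tripleTermList c γX γY γZ) ε) :
    levelSeq z ∈ levelBlocksX (coarseTermMap (isLevelTriple_of_mem_jointTypeClass hQs hT₀))
      (coarseTermList c (typeAlpha n Q)
        (cellGammaFun (tripleTermMap (isLevelTriple_of_mem_jointTypeClass hQs hT₀))
          (profileOf q (tripleTermMap (isLevelTriple_of_mem_jointTypeClass hQs hT₀)) z))) 0 := by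
  have hlev := isLevelTriple_of_mem_jointTypeClass hQs hT₀
  have hα := isAlphaConsistent_typeAlpha hT₀
  obtain ⟨hlz, hu⟩ := isUsefulFor_cell q hlev hz (profileOf q (tripleTermMap hlev) z) (profileOf q (tripleTermMap hlev) z)
  exact (mem_levelBlocksX_coarse_iff hlev (levelSeq z)).2
    ⟨hlz, (isCompatibleWith_iff_isCompatibleWith' hlev hα).1 (hu.isCompatibleWith hlev hα)⟩

/-- **VXXZ Thm. 5.3, one copy of the input per cell** (Prop. 5.1 applied with the realised split
distributions of a cell of `𝒯_{τ₀, L(γ), ε}` as targets): for a joint type `Q` (`∑ Q = n`, supported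
on level triples), a triple `T₀` of type `Q` (term map `τ₀`), target split distributions `γ` and a
non-zero entry `(x, y, z)` of the `ε`-interface tensor, `(CW_q^{⊗c})^{⊗n}` restricts to `⟨κ⟩` copies
of the EXACT interface tensor of the cell of `(x, y, z)`, with
`log₂(κ+1) ≥ n · min{H(Q_X/n) − P, H(Q_Y/n) − P, H(θ_z/n) − Λ_z/n, H(Q/n)} − thm53Err`, where
`P = maxEnt(Q/n) − H(Q/n)` is the penalty at the type, `θ_z` the joint type of `(K₀, ẑ)` and
`Λ_z = ∑_S |S| H(k_S/|S|)` for the class types `k_S` of `ẑ` (`= n λ_Z` at the realised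
distributions). [cite: VassilevskaWilliamsXuXuZhou2024, Thm. 5.3 (proof) and Prop. 5.1] -/
theorem vxxz2024_thm53_cell (hc : 0 < c) (hn : 0 < n) (hQ : ∑ s, Q s = n)
    (hQs : ∀ s, s ∉ levelSupport (2 * c) → Q s = 0) (hT₀ : T₀ ∈ jointTypeClass n Q)
    (hxyz : interfaceTensor K q (tripleTermMap (isLevelTriple_of_mem_jointTypeClass hQs hT₀)) (tripleTermList c γX γY γZ) ε x y z ≠ 0) :
    ∃ κ : ℕ,
      TensorRestrictsTo (kroneckerPow (kroneckerPow (bigCwTensor K q) c) n)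
        (kroneckerTensor (unitTensor K κ)
          (interfaceTensor K q (tripleTermMap (isLevelTriple_of_mem_jointTypeClass hQs hT₀))
            (cellTermList (tripleTermMap (isLevelTriple_of_mem_jointTypeClass hQs hT₀)) (tripleTermList c γX γY γZ)
              (profileOf q (tripleTermMap (isLevelTriple_of_mem_jointTypeClass hQs hT₀)) x,
                profileOf q (tripleTermMap (isLevelTriple_of_mem_jointTypeClass hQs hT₀)) y,
                profileOf q (tripleTermMap (isLevelTriple_of_mem_jointTypeClass hQs hT₀)) z)) 0)) ∧
      (n : ℝ) * min (min (shannonEntropy (fun i => ((∑ j, ∑ l, Q (i, j, l) : ℕ) : ℝ) / n) -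
              (maxEntropyGivenMarginals (levelSupport (2 * c)) (fun s => (Q s : ℝ) / n) - shannonEntropy (fun s => (Q s : ℝ) / n)))
            (shannonEntropy (fun j => ((∑ i, ∑ l, Q (i, j, l) : ℕ) : ℝ) / n) -
              (maxEntropyGivenMarginals (levelSupport (2 * c)) (fun s => (Q s : ℝ) / n) - shannonEntropy (fun s => (Q s : ℝ) / n))))
          (min (shannonEntropy (fun a => (letterCount (GlobalStageData.pairSeq T₀.2.2 (levelSeq z)) a : ℝ) / n) -
              (∑ s, ((termFibre (coarseTermMap (isLevelTriple_of_mem_jointTypeClass hQs hT₀)) s).card : ℝ) *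
                shannonEntropy (fun σ => (coarseProfile (isLevelTriple_of_mem_jointTypeClass hQs hT₀) (levelSeq z) s σ : ℝ) /
                  (termFibre (coarseTermMap (isLevelTriple_of_mem_jointTypeClass hQs hT₀)) s).card)) / n)
            (shannonEntropy (fun s => (Q s : ℝ) / n))) - thm53Err c n ≤
        Real.logb 2 ((κ : ℝ) + 1) := by
  classical
  have hlev := isLevelTriple_of_mem_jointTypeClass hQs hT₀
  obtain ⟨hxm, hym, hzm⟩ := interfaceTensor_ne_zero K q hxyz
  set τ₀ := tripleTermMap (isLevelTriple_of_mem_jointTypeClass hQs hT₀) with hτ₀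
  set D := cellData Q τ₀ (profileOf q τ₀ x, profileOf q τ₀ y, profileOf q τ₀ z) with hDdef
  have hD : D.WellFormed := cellData_wellFormed K q hQs hT₀ hxyz
  have hS : D.Symmetric := cellData_symmetric Q _ _
  have hT₀' : T₀ ∈ D.𝒯α := hT₀
  have hp₀ : (T₀.2.2, levelSeq z) ∈ D.typicalPairs := mem_typicalPairs_cell q hQs hT₀ hzm _ _
  have hcoarse := mem_levelBlocksX_coarse_cell q hQs hT₀ hzm
  obtain ⟨M, B, -, -, -, -, -, hres⟩ := D.vxxz2024_prop51_region_logb hD hS K q hc hn hT₀' hp₀ (Q := Q) rfl hQ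
    rfl rfl rfl (coarseProfile hlev (levelSeq z)) (fun s σ => coarseProfile_eq_mul hlev hcoarse s σ)
    (fun s σ hne => patternLevel_of_coarseProfile_ne_zero hlev hcoarse hne) (sum_coarseProfile hlev (levelSeq z))
  obtain ⟨hrest, hbound⟩ := hres (le_refl (8 ^ (3 * Nat.log (2 * (c * n)) (3 ^ (c * n)) + 3)))
  refine ⟨B.card * D.𝒯α.card / (2 * M ^ 2 * 8 ^ (3 * Nat.log (2 * (c * n)) (3 ^ (c * n)) + 3)), ?_, ?_⟩
  · rw [cellData_starTensor_eq K q hlev γX γY γZ] at hrest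
    exact hrest
  · have hsq := sqrt_log_modulusBound_le D (T₀.2.2, levelSeq z)
    refine le_trans ?_ hbound
    simp only [hDdef, cellData_μX, cellData_μY] at hbound hsq ⊢
    unfold thm53Err
    linarith

end Cell



end Literature.Computability.AlgebraicComplexity
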